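import Literature.AnabelianGeometry.SemiGraphs.TemperedReconstructionEdgeVertexProofs
import Literature.AnabelianGeometry.SemiGraphs.TemperedCompactInVerticialAt
import HarnessLib

/-!
# Semi-graphs of anabelioids, §3: Corollary 3.9 — compatibility of the edge map with the vertex map, AT ONE PAIR OF GRAPHS

Mochizuki, *Semi-graphs of anabelioids*, Publ. RIMS **42** (2006), §3, Corollary 3.9, proof, manuscript
p. 42 [cite: MochizukiSemiAnbd2006, Cor 3.9 p.42]: "a map from the edges of `G` to the edges of `H`
which is compatible with the map obtained above on vertices".

PROOF-ONLY companion (abc-iut cell, L3-lead ruling α4-3 «φ2-CONSUMERS», block B0d, seat abc-iut-L3-d1)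
of `TemperedReconstructionEdgeVertexProofs.lean` (abc-iut-L3-t2 lineage): the SAME proofs of
`edgeMap_abuts_vertexMap` and `edgeMap_abuts_vertexMap_of_isQuasiGeometric`, with the ∀-countable
named fact `CompactInVerticial` (Thm. 3.7 (iii)) replaced by its per-graph form `CompactInVerticialAt`
(`TemperedCompactInVerticialAt.lean`, abc-iut-w4-d075) at the ONE graph `ℋ` where the proof instantiates
it.  Port rule (α4-3): `(h37iii : CompactInVerticial)` ↦ `(h37iii : CompactInVerticialAt ℋ)`,
`h37iii ℋ hℋ c ↦ h37iii hℋ c`, decl suffix `_at`; everything else verbatim; the original is untouched (its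
fact-free lemmas `vertex_eq_of_mem_verticialSubgroups`, `exists_verticial_pair_of_mem_edgeLikeSubgroups`,
… are reused by name).  Nothing here takes a side on [IUTchIII] Cor. 3.12; typed ≠ discharged.
-/

open CategoryTheory Topology

namespace Literature.AnabelianGeometry.SemiGraphs

namespace ProfiniteSemiGraph

universe u

variable {𝒢 ℋ : ProfiniteSemiGraph.{u}}

/-- A subgroup of finite index (`relIndex ≠ 0`) in an infinite subgroup is nontrivial (local copy of the
original file's private lemma). [folklore] -/
private theorem ne_bot_of_relIndex_ne_zero {Γ : Type u} [Group Γ] {C L : Subgroup Γ} [Infinite L]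
    (h : C.relIndex L ≠ 0) : C ≠ ⊥ := by
  rintro rfl
  rw [Subgroup.relIndex_bot_left, Nat.card_eq_zero_of_infinite] at h
  exact h rfl

/-- **`f_E(e)` abuts to `f_V(v)` whenever `e` abuts to `v`, from Thm. 3.7 (iii) AT `ℋ`** ([SemiAnbd]
Cor. 3.9, proof, p. 42), with Thm. 3.7 (i), (ii): `φ` carries a nontrivial edge-like `L ≤ K_v` to `φ(L)`,
open in an (infinite) edge-like `L₂` at `f_E(e)` and contained in a verticial `K₂` at `f_V(v)`; `L₂` lies
in two distinct verticial subgroups at the end-vertices of `f_E(e)`, and a nontrivial compact subgroup lies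
in at most two verticial subgroups (Thm. 3.7 (iii) at `ℋ`), so `K₂` is one of them (φ2-consumers twin of
`edgeMap_abuts_vertexMap`). [cite: MochizukiSemiAnbd2006, Cor 3.9 p.42] -/
theorem edgeMap_abuts_vertexMap_at (h37i : VerticialInjective.{u}) (h37iii : CompactInVerticialAt ℋ)
    (hℋ : Cor39Hypotheses ℋ) (c𝒢 : TemperedPiChart 𝒢) (cℋ : TemperedPiChart ℋ)
    (φ : c𝒢.G →ₜ* cℋ.G) {e : 𝒢.graph.Edge} {L K : Subgroup c𝒢.G}
    (hL : L ∈ edgeLikeSubgroups c𝒢 e) (hLK : L ≤ K)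
    {e' : ℋ.graph.Edge} {w : ℋ.graph.Vertex} {L₂ K₂ : Subgroup cℋ.G}
    (hL₂ : L₂ ∈ edgeLikeSubgroups cℋ e') (hmapsL : MapsOntoOpenSubgroupOf φ.toMonoidHom L L₂)
    (hK₂ : K₂ ∈ verticialSubgroups cℋ w) (hmapsK : K.map φ.toMonoidHom ≤ K₂) :
    ℋ.graph.EdgeAbuts e' w := by
  haveI := cℋ.t2Space
  have h37 := hℋ.thm37Hypotheses
  -- the two branches of the closed edge `e'`
  obtain ⟨b₁, b₂, hb, hb₁, hb₂, -⟩ := ℋ.graph.two_branches e'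
  obtain ⟨w₁, hw₁⟩ := Option.isSome_iff_exists.mp (hℋ.isGraph.abuts_isSome b₁)
  obtain ⟨w₂, hw₂⟩ := Option.isSome_iff_exists.mp (hℋ.isGraph.abuts_isSome b₂)
  obtain ⟨H₁, hH₁, H₂, hH₂, hne, hL₂H₁, hL₂H₂⟩ :=
    exists_verticial_pair_of_mem_edgeLikeSubgroups h37i hℋ cℋ hb hb₁ hb₂ hw₁ hw₂ hL₂
  -- `C := φ(L)`: compact, nontrivial, in `K₂`, `H₁`, `H₂`
  have hC : IsCompact ((L.map φ.toMonoidHom : Subgroup cℋ.G) : Set cℋ.G) := by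
    rw [Subgroup.coe_map]
    exact (isCompact_of_mem_edgeLikeSubgroups c𝒢 hL).image φ.continuous
  haveI : Infinite L₂ := infinite_of_mem_edgeLikeSubgroups h37i h37 cℋ hL₂
  have hC0 : L.map φ.toMonoidHom ≠ ⊥ :=
    ne_bot_of_relIndex_ne_zero
      (relIndex_ne_zero_of_mapsOnto φ.toMonoidHom (isCompact_of_mem_edgeLikeSubgroups cℋ hL₂) hmapsL)
  have hCK₂ : L.map φ.toMonoidHom ≤ K₂ := (Subgroup.map_mono hLK).trans hmapsK
  have hCH₁ : L.map φ.toMonoidHom ≤ H₁ := hmapsL.1.trans hL₂H₁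
  have hCH₂ : L.map φ.toMonoidHom ≤ H₂ := hmapsL.1.trans hL₂H₂
  obtain ⟨hall, -⟩ := (h37iii h37 cℋ _ hC).2 hC0 w₁ w₂ H₁ H₂ hH₁ hH₂ hne hCH₁ hCH₂
  rcases hall w K₂ hK₂ hCK₂ with rfl | rfl
  · exact ⟨b₁, hb₁, (vertex_eq_of_mem_verticialSubgroups h37 cℋ hK₂ hH₁) ▸ hw₁⟩
  · exact ⟨b₂, hb₂, (vertex_eq_of_mem_verticialSubgroups h37 cℋ hK₂ hH₂) ▸ hw₂⟩

/-- **Compatibility of the maps of Cor. 3.9 (b), from Thm. 3.7 (iii) AT `ℋ`**: with `f_V`, `f_E` the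
vertex and edge maps determined by a quasi-geometric `φ`, every edge `e` abutting to `v` has `f_E(e)`
abutting to `f_V(v)` (φ2-consumers twin of `edgeMap_abuts_vertexMap_of_isQuasiGeometric`).
[cite: MochizukiSemiAnbd2006, Cor 3.9 p.42] -/
theorem edgeMap_abuts_vertexMap_of_isQuasiGeometric_at (h37i : VerticialInjective.{u})
    (h37iii : CompactInVerticialAt ℋ) (h𝒢 : Cor39Hypotheses 𝒢) (hℋ : Cor39Hypotheses ℋ)
    (c𝒢 : TemperedPiChart 𝒢) (cℋ : TemperedPiChart ℋ) (φ : c𝒢.G →ₜ* cℋ.G)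
    {fV : 𝒢.graph.Vertex → ℋ.graph.Vertex} {fE : 𝒢.graph.Edge → ℋ.graph.Edge}
    (hfV : ∀ (v : 𝒢.graph.Vertex) (K : Subgroup c𝒢.G), K ∈ verticialSubgroups c𝒢 v →
      ∃ K₂ ∈ verticialSubgroups cℋ (fV v), MapsOntoOpenSubgroupOf φ.toMonoidHom K K₂)
    (hfE : ∀ (e : 𝒢.graph.Edge) (L : Subgroup c𝒢.G), L ∈ edgeLikeSubgroups c𝒢 e →
      ∃ L₂ ∈ edgeLikeSubgroups cℋ (fE e), MapsOntoOpenSubgroupOf φ.toMonoidHom L L₂)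
    {b : 𝒢.graph.Branch} {v : 𝒢.graph.Vertex} (hbv : 𝒢.graph.abuts b = some v) :
    ℋ.graph.EdgeAbuts (fE (𝒢.graph.edgeOf b)) (fV v) := by
  obtain ⟨L, hL, -⟩ := exists_mem_edgeLikeSubgroups_ne_bot h37i h𝒢 c𝒢 (𝒢.graph.edgeOf b)
  obtain ⟨K, hK, hLK⟩ :=
    exists_mem_verticialSubgroups_ge c𝒢 hbv hL (h37i 𝒢 h𝒢.thm37Hypotheses c𝒢 v).1
  obtain ⟨K₂, hK₂, hmapsK⟩ := hfV v K hK
  obtain ⟨L₂, hL₂, hmapsL⟩ := hfE (𝒢.graph.edgeOf b) L hL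
  exact edgeMap_abuts_vertexMap_at h37i h37iii hℋ c𝒢 cℋ φ hL hLK hL₂ hmapsL hK₂ hmapsK.1

end ProfiniteSemiGraph

end Literature.AnabelianGeometry.SemiGraphs
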